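/-
Copyright: the b2b-balaban T⁴-continuum CRUX team, row NE7b OWNER lineage `t4-ne7b-p1` (gen 108). Project licence.
-/
import Summits.QuantumFields.BalabanUV.T4Continuum.Spine.NE7b.ConvexWindowExponentShift

/-!
# THE WINDOWED EXPONENT SHIFT FROM THREE NUMBERS AT THE EXPANSION POINT: value `W(x₀) ≤ A₀`, gradient `‖∇W x₀‖ ≤ A₁`, Hessian
# `D²W ≤ 2b` ON the window ⟹ `∫_K e^{−V} ≤ exp(A₀ + A₁R + bR²)·∫_K e^{−(V+W)}`, `R = G₀∕λ + √(n∕λ)`, and `LocCondStability` BY NAME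
# (row NE7b, node U5c; residual (R2′) family (2) — the growth letter of `…ConvexWindowExponentShift` SUPPLIED from a second-order Taylor
# letter, the way print controls its expansions about the background)

Cell `pub-balaban`, sub-cell `t4`, spine estimate NE7b (`T4WeightBudget.RelWeightBound`; the cell's OWN estimate — NOT PRINTED in
[Bałaban 1983–89], NOT PROVED).  Crux-route work under `Spine/NE7b/` by the row's OWNER; NOTHING of Bałaban's is named or asserted;
no `T4Continuum/Support` leaf typed; no `def`; zero `sorry`.

WHY.  `…ConvexWindowExponentShift` sockets the one-step ratio `∫_K e^{−V} ∕ ∫_K e^{−(V+W)}` under the one-sided growth letter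
`W ≤ a + b‖· − x₀‖²` ON the window.  An exponent difference produced by an expansion about the background is controlled by its VALUE,
GRADIENT and a HESSIAN bound at ∕ around the expansion point — a second-order Taylor letter `W(y) ≤ W(x₀) + ⟪∇W x₀, y − x₀⟫ + b‖y − x₀‖²`
(from `D²W ≤ 2b` ON `K`, by `…ConvexWindowSuppliers.firstOrderOn_of_hessianOn_lower` applied to `−W`).  Under the numerator's windowed
tilt the LINEAR term is paid by leaf-01's `hcrit`-free mean-vector letter `|⟨⟪w, y − x₀⟫⟩| ≤ ‖w‖(‖∇V x₀‖∕λ + √(n∕λ))`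
(`…ConvexWindowMinimiserTilted.abs_windowTiltedMean_inner_sub_le_of_gradient_sharp`) and the QUADRATIC term by
`sqrt_integral_norm_sub_sq_windowTilted_le_of_gradient`: `⟨W⟩ ≤ A₀ + A₁R + bR²`, `R = ‖∇V x₀‖∕λ + √(n∕λ)`.  The socket's numbers become
`lam, A₀, A₁, b, G₀` — all read AT the expansion point or as a Hessian bound ON the window; no growth letter to verify pointwise.

WHAT IS PROVED ([folklore]):
* §1 `inner_gradient_neg`, **`taylorGrowth_of_hessian_upper`**: `K` convex, `W ∈ C²`, `D²W(x)[v,v] ≤ 2b‖v‖²` for `x ∈ K` ⟹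
  `W y ≤ W x₀ + ⟪∇W x₀, y − x₀⟫ + b‖y − x₀‖²` for `x₀, y ∈ K`.
* §2 **`windowTiltedMean_le_of_taylorGrowth_of_gradient`**: `W ≤ a + ⟪w, · − x₀⟫ + b‖· − x₀‖²` on `K` (`b ≥ 0`), `K` convex bounded
  measurable of positive volume, `x₀ ∈ K`, `V ∈ C¹` `λ`-convex ON `K` ⟹ `∫ W dν_{V,K} ≤ a + ‖w‖R + bR²`, `R = ‖∇V x₀‖∕λ + √(n∕λ)`.
* §3 ENDs **`exp_shift_le_of_taylorGrowth_on_boundedConvexWindow_of_gradient`** (`∫_K e^{−V} ≤ exp(a + ‖w‖R + bR²)·∫_K e^{−(V+W)}`) and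
  **`exp_shift_le_of_hessian_upper_on_boundedConvexWindow_of_gradient`** (`W ∈ C²`, `D²W ≤ 2b` ON `K`, `b ≥ 0`: `a = W x₀`, `w = ∇W x₀`);
  `taylorGrowthCarrier_le` (numbers `W x₀ ≤ A₀`, `‖∇W x₀‖ ≤ A₁`, `‖∇V x₀‖ ≤ G₀`: carrier `≤ exp(A₀ + A₁R₀ + bR₀²)`, `R₀ = G₀∕λ + √(n∕λ)`).
* §4 the junction BY NAME **`locCondStability_of_taylorGrowthCarrier_on_support`**: per `(j, g, y)` window, exponents `V`, `W`, nominal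
  centre `x0` (background-dependent allowed); ON THE SUPPORT: `Kw` convex bounded measurable with `x0 ∈ Kw`, `V ∈ C¹` `lam`-convex ON `Kw`,
  `‖∇V x0‖ ≤ G₀`, `W ∈ C²` with `D²W ≤ 2b` ON `Kw`, `W x0 ≤ A₀`, `‖∇W x0‖ ≤ A₁` — the numbers `lam, A₀, A₁, b, G₀` y-UNIFORM ⟹
  `LocCondStability T S K μ ρ₀ M (A₀ + A₁R₀ + bR₀²)`.

NOT HERE (honest): the five numbers by value and the identification of print's exponent difference ((A1c)∕(A3) readings; NC-NE7b-α);
anything of Bałaban's.  NE7b NOT PRINTED ∕ NOT PROVED; spine PROVED 0∕9; rung (B)+1 on a FINITE torus — NOT infinite volume, NOT the mass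
gap, NOT Clay.
HONEST DEPENDENCY: continuum YM on T⁴ ⇐ BetaPertH ∧ nine spine estimates (0/9 proved); BetaPertH ⇐ (D1) ∧ (D4) ∧ CAP+tail.
-/

set_option autoImplicit false

noncomputable section

open MeasureTheory Real Finset
open scoped RealInnerProductSpace
open Summit.QuantumFields.BalabanUV.T4Continuum.B16HistoryIndexedRepr Summit.QuantumFields.BalabanUV.T4Continuum.B16HistoryReprChain
open Summit.QuantumFields.BalabanUV.T4Continuum.NE7b.PrefixExtraction Summit.QuantumFields.BalabanUV.T4Continuum.NE7b.LocalConditionalStability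
open Summit.QuantumFields.BalabanUV.T4Continuum.NE7b.CarrierOnSupport
open Summit.QuantumFields.BalabanUV.T4Continuum.NE7b.ConvexWindowTiltMoment
open Summit.QuantumFields.BalabanUV.T4Continuum.NE7b.ConvexWindowVirial
open Summit.QuantumFields.BalabanUV.T4Continuum.NE7b.ConvexWindowSuppliers
open Summit.QuantumFields.BalabanUV.T4Continuum.NE7b.ConvexWindowTiltCentred
open Summit.QuantumFields.BalabanUV.T4Continuum.NE7b.ConvexWindowMinimiserTilted
open Summit.QuantumFields.BalabanUV.T4Continuum.NE7b.ConvexWindowExponentShift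

namespace Summit.QuantumFields.BalabanUV.T4Continuum.NE7b.ConvexWindowTaylorGrowth

variable {n : ℕ}

/-! ## §1 The second-order Taylor letter from a Hessian upper bound ON the window -/

/-- `⟪∇(−W) x, v⟫ = −⟪∇W x, v⟫` (no differentiability needed: both sides are junk together). [folklore] -/
theorem inner_gradient_neg (W : EuclideanSpace ℝ (Fin n) → ℝ) (x v : EuclideanSpace ℝ (Fin n)) :
    ⟪gradient (fun y => -W y) x, v⟫ = -⟪gradient W x, v⟫ := by
  rw [inner_gradient_eq_fderiv, inner_gradient_eq_fderiv, fderiv_fun_neg, neg_apply]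

/-- **THE SECOND-ORDER TAYLOR LETTER ON A CONVEX WINDOW**: `K` convex, `W ∈ C²`, `D²W(x)[v, v] ≤ 2b‖v‖²` for `x ∈ K` ⟹
`W y ≤ W x₀ + ⟪∇W x₀, y − x₀⟫ + b‖y − x₀‖²` for all `x₀, y ∈ K` — `…ConvexWindowSuppliers.firstOrderOn_of_hessianOn_lower` for `−W`
with modulus `−2b`. [folklore] -/
theorem taylorGrowth_of_hessian_upper {W : EuclideanSpace ℝ (Fin n) → ℝ} {b : ℝ} {K : Set (EuclideanSpace ℝ (Fin n))}
    (hK : Convex ℝ K) (hW : ContDiff ℝ 2 W)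
    (hH : ∀ x ∈ K, ∀ v : EuclideanSpace ℝ (Fin n), iteratedFDeriv ℝ 2 W x ![v, v] ≤ 2 * b * ‖v‖ ^ 2)
    {x₀ : EuclideanSpace ℝ (Fin n)} (hx₀ : x₀ ∈ K) {y : EuclideanSpace ℝ (Fin n)} (hy : y ∈ K) :
    W y ≤ W x₀ + ⟪gradient W x₀, y - x₀⟫ + b * ‖y - x₀‖ ^ 2 := by
  have hH' : ∀ x ∈ K, ∀ v : EuclideanSpace ℝ (Fin n),
      -(2 * b) * ‖v‖ ^ 2 ≤ iteratedFDeriv ℝ 2 (fun y => -W y) x ![v, v] := fun x hx v => by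
    have e : (fun y => -W y) = -W := rfl
    rw [e, iteratedFDeriv_neg_apply, neg_apply]
    linarith [hH x hx v]
  have h := firstOrderOn_of_hessianOn_lower hK hW.neg hH' x₀ hx₀ y hy
  rw [inner_gradient_neg] at h
  linarith

/-! ## §2 The windowed tilted mean of `W` under a Taylor growth letter, no centre letter -/

/-- **THE WINDOWED TILTED MEAN UNDER A TAYLOR GROWTH LETTER.**  `K` convex, bounded, measurable, of positive volume; `x₀ ∈ K`; `V ∈ C¹`,
`λ`-uniformly convex ON `K`; `W` continuous with `W y ≤ a + ⟪w, y − x₀⟫ + b‖y − x₀‖²` on `K`, `b ≥ 0`.  Then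
`∫ W dν_{V,K} ≤ a + ‖w‖·R + b·R²`, `R = ‖∇V x₀‖∕λ + √(n∕λ)` — the linear term by leaf-01's sharp mean-vector letter, the quadratic term by
its sharp second-moment letter. [folklore] -/
theorem windowTiltedMean_le_of_taylorGrowth_of_gradient {V W : EuclideanSpace ℝ (Fin n) → ℝ} {lam a b : ℝ}
    {w : EuclideanSpace ℝ (Fin n)} {K : Set (EuclideanSpace ℝ (Fin n))} (hlam : 0 < lam) (hK : Convex ℝ K)
    (hKm : MeasurableSet K) (hKb : Bornology.IsBounded K) (hK0 : volume K ≠ 0) {x₀ : EuclideanSpace ℝ (Fin n)} (hx₀ : x₀ ∈ K)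
    (hV1 : ContDiff ℝ 1 V) (hV : ∀ x ∈ K, ∀ y ∈ K, V x + ⟪gradient V x, y - x⟫ + lam / 2 * ‖y - x‖ ^ 2 ≤ V y)
    (hWc : Continuous W) (hb : 0 ≤ b) (hW : ∀ y ∈ K, W y ≤ a + ⟪w, y - x₀⟫ + b * ‖y - x₀‖ ^ 2) :
    ∫ y, W y ∂((volume.restrict K).tilted fun x => -V x) ≤
      a + ‖w‖ * (‖gradient V x₀‖ / lam + Real.sqrt (n / lam)) + b * (‖gradient V x₀‖ / lam + Real.sqrt (n / lam)) ^ 2 := by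
  set ν : Measure (EuclideanSpace ℝ (Fin n)) := (volume.restrict K).tilted fun x => -V x with hν
  set R : ℝ := ‖gradient V x₀‖ / lam + Real.sqrt (n / lam) with hR
  haveI : NeZero (volume.restrict K : Measure (EuclideanSpace ℝ (Fin n))) :=
    ⟨fun h => hK0 (Measure.restrict_eq_zero.1 h)⟩
  haveI : IsProbabilityMeasure ν := isProbabilityMeasure_tilted (integrableOn_exp_neg_of_isBounded hKb hV1.continuous)
  have hWi : Integrable W ν := integrable_windowTilted_of_isBounded hKb hV1.continuous hWc
  have h1 : Integrable (fun y : EuclideanSpace ℝ (Fin n) => ⟪w, y - x₀⟫) ν :=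
    integrable_windowTilted_of_isBounded hKb hV1.continuous (continuous_const.inner (continuous_id.sub continuous_const))
  have h2 : Integrable (fun y : EuclideanSpace ℝ (Fin n) => ‖y - x₀‖ ^ 2) ν :=
    integrable_windowTilted_of_isBounded hKb hV1.continuous ((continuous_id.sub continuous_const).norm.pow 2)
  have hmono : ∫ y, W y ∂ν ≤ ∫ y, (a + ⟪w, y - x₀⟫ + b * ‖y - x₀‖ ^ 2) ∂ν := by
    refine integral_mono_ae hWi (((integrable_const a).add h1).add (h2.const_mul b)) ?_
    filter_upwards [ae_mem_windowTilted (V := V) hKm] with y hy using hW y hy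
  have e : ∫ y, (a + ⟪w, y - x₀⟫ + b * ‖y - x₀‖ ^ 2) ∂ν = a + ∫ y, ⟪w, y - x₀⟫ ∂ν + b * ∫ y, ‖y - x₀‖ ^ 2 ∂ν := by
    have e1 : ∫ y, (a + ⟪w, y - x₀⟫ + b * ‖y - x₀‖ ^ 2) ∂ν = (∫ y, (a + ⟪w, y - x₀⟫) ∂ν) + ∫ y, b * ‖y - x₀‖ ^ 2 ∂ν :=
      integral_add ((integrable_const a).add h1) (h2.const_mul b)
    have e2 : ∫ y, (a + ⟪w, y - x₀⟫) ∂ν = (∫ _y, a ∂ν) + ∫ y, ⟪w, y - x₀⟫ ∂ν := integral_add (integrable_const a) h1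
    rw [e1, e2, integral_const_mul, integral_const, smul_eq_mul, probReal_univ, one_mul]
  rw [e] at hmono
  have hlin : ∫ y, ⟪w, y - x₀⟫ ∂ν ≤ ‖w‖ * R :=
    (le_abs_self _).trans (abs_windowTiltedMean_inner_sub_le_of_gradient_sharp hlam hK hKm hKb hK0 hx₀ hV1 hV w)
  have hM0 : 0 ≤ ∫ y, ‖y - x₀‖ ^ 2 ∂ν := integral_nonneg fun _ => sq_nonneg _
  have hsqrt := sqrt_integral_norm_sub_sq_windowTilted_le_of_gradient hlam hK hKm hKb hK0 hx₀ hV1 hV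
  have hpow := pow_le_pow_left₀ (Real.sqrt_nonneg _) hsqrt 2
  rw [Real.sq_sqrt hM0] at hpow
  have hquad := mul_le_mul_of_nonneg_left hpow hb
  linarith

/-! ## §3 The ENDs and the carrier -/

/-- **THE WINDOWED EXPONENT SHIFT UNDER A TAYLOR GROWTH LETTER.**  `K` convex, bounded, measurable; `x₀ ∈ K`; `V ∈ C¹`, `λ`-uniformly
convex ON `K`; `W` continuous with `W ≤ a + ⟪w, · − x₀⟫ + b‖· − x₀‖²` on `K`, `b ≥ 0`.  Then, with `R = ‖∇V x₀‖∕λ + √(n∕λ)`,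
`∫_K e^{−V} ≤ exp(a + ‖w‖R + bR²) · ∫_K e^{−(V+W)}`. [folklore] -/
theorem exp_shift_le_of_taylorGrowth_on_boundedConvexWindow_of_gradient {V W : EuclideanSpace ℝ (Fin n) → ℝ} {lam a b : ℝ}
    {w : EuclideanSpace ℝ (Fin n)} {K : Set (EuclideanSpace ℝ (Fin n))} (hlam : 0 < lam) (hK : Convex ℝ K)
    (hKm : MeasurableSet K) (hKb : Bornology.IsBounded K) {x₀ : EuclideanSpace ℝ (Fin n)} (hx₀ : x₀ ∈ K) (hV1 : ContDiff ℝ 1 V)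
    (hV : ∀ x ∈ K, ∀ y ∈ K, V x + ⟪gradient V x, y - x⟫ + lam / 2 * ‖y - x‖ ^ 2 ≤ V y)
    (hWc : Continuous W) (hb : 0 ≤ b) (hW : ∀ y ∈ K, W y ≤ a + ⟪w, y - x₀⟫ + b * ‖y - x₀‖ ^ 2) :
    ∫ x in K, exp (-V x) ≤
      exp (a + ‖w‖ * (‖gradient V x₀‖ / lam + Real.sqrt (n / lam)) + b * (‖gradient V x₀‖ / lam + Real.sqrt (n / lam)) ^ 2) *
        ∫ x in K, exp (-(V x + W x)) := by
  by_cases hK0 : volume K = 0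
  · have h0m : (volume.restrict K : Measure (EuclideanSpace ℝ (Fin n))) = 0 := Measure.restrict_eq_zero.2 hK0
    rw [h0m, integral_zero_measure, integral_zero_measure, mul_zero]
  exact (setIntegral_exp_neg_le_exp_windowTiltedMean_mul hKb hV1.continuous hWc).trans
    (mul_le_mul_of_nonneg_right
      (exp_le_exp.2 (windowTiltedMean_le_of_taylorGrowth_of_gradient hlam hK hKm hKb hK0 hx₀ hV1 hV hWc hb hW))
      (integral_nonneg fun _ => (exp_pos _).le))

/-- **THE WINDOWED EXPONENT SHIFT FROM A HESSIAN UPPER BOUND ON THE DIFFERENCE.**  `K` convex, bounded, measurable; `x₀ ∈ K`; `V ∈ C¹`,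
`λ`-uniformly convex ON `K`; `W ∈ C²` with `D²W(x)[v, v] ≤ 2b‖v‖²` for `x ∈ K`, `b ≥ 0`.  Then, with `R = ‖∇V x₀‖∕λ + √(n∕λ)`,
`∫_K e^{−V} ≤ exp(W x₀ + ‖∇W x₀‖R + bR²) · ∫_K e^{−(V+W)}` — value, gradient and Hessian bound of the difference at ∕ around the
expansion point, nothing else. [folklore] -/
theorem exp_shift_le_of_hessian_upper_on_boundedConvexWindow_of_gradient {V W : EuclideanSpace ℝ (Fin n) → ℝ} {lam b : ℝ}
    {K : Set (EuclideanSpace ℝ (Fin n))} (hlam : 0 < lam) (hK : Convex ℝ K) (hKm : MeasurableSet K)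
    (hKb : Bornology.IsBounded K) {x₀ : EuclideanSpace ℝ (Fin n)} (hx₀ : x₀ ∈ K) (hV1 : ContDiff ℝ 1 V)
    (hV : ∀ x ∈ K, ∀ y ∈ K, V x + ⟪gradient V x, y - x⟫ + lam / 2 * ‖y - x‖ ^ 2 ≤ V y)
    (hW2 : ContDiff ℝ 2 W) (hb : 0 ≤ b)
    (hH : ∀ x ∈ K, ∀ v : EuclideanSpace ℝ (Fin n), iteratedFDeriv ℝ 2 W x ![v, v] ≤ 2 * b * ‖v‖ ^ 2) :
    ∫ x in K, exp (-V x) ≤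
      exp (W x₀ + ‖gradient W x₀‖ * (‖gradient V x₀‖ / lam + Real.sqrt (n / lam)) +
          b * (‖gradient V x₀‖ / lam + Real.sqrt (n / lam)) ^ 2) * ∫ x in K, exp (-(V x + W x)) :=
  exp_shift_le_of_taylorGrowth_on_boundedConvexWindow_of_gradient hlam hK hKm hKb hx₀ hV1 hV hW2.continuous hb
    fun _ hy => taylorGrowth_of_hessian_upper hK hW2 hH hx₀ hy

/-- The Taylor-growth carrier `∫_K e^{−V} ∕ ∫_K e^{−(V+W)}` is at most `exp(A₀ + A₁R₀ + bR₀²)`, `R₀ = G₀∕λ + √(n∕λ)`, once `W x₀ ≤ A₀`,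
`‖∇W x₀‖ ≤ A₁`, `‖∇V x₀‖ ≤ G₀` (`W ∈ C²` with `D²W ≤ 2b` ON `K`, `b ≥ 0`). [folklore] -/
theorem taylorGrowthCarrier_le {V W : EuclideanSpace ℝ (Fin n) → ℝ} {lam b A₀ A₁ G₀ : ℝ} {K : Set (EuclideanSpace ℝ (Fin n))}
    (hlam : 0 < lam) (hK : Convex ℝ K) (hKm : MeasurableSet K) (hKb : Bornology.IsBounded K)
    {x₀ : EuclideanSpace ℝ (Fin n)} (hx₀ : x₀ ∈ K) (hV1 : ContDiff ℝ 1 V)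
    (hV : ∀ x ∈ K, ∀ y ∈ K, V x + ⟪gradient V x, y - x⟫ + lam / 2 * ‖y - x‖ ^ 2 ≤ V y) (hG : ‖gradient V x₀‖ ≤ G₀)
    (hW2 : ContDiff ℝ 2 W) (hb : 0 ≤ b)
    (hH : ∀ x ∈ K, ∀ v : EuclideanSpace ℝ (Fin n), iteratedFDeriv ℝ 2 W x ![v, v] ≤ 2 * b * ‖v‖ ^ 2)
    (hA₀ : W x₀ ≤ A₀) (hA₁ : ‖gradient W x₀‖ ≤ A₁) :
    (∫ x in K, exp (-V x)) / (∫ x in K, exp (-(V x + W x))) ≤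
      exp (A₀ + A₁ * (G₀ / lam + Real.sqrt (n / lam)) + b * (G₀ / lam + Real.sqrt (n / lam)) ^ 2) := by
  refine div_le_of_le_mul₀ (integral_nonneg fun _ => (exp_pos _).le) (exp_pos _).le ?_
  refine (exp_shift_le_of_hessian_upper_on_boundedConvexWindow_of_gradient hlam hK hKm hKb hx₀ hV1 hV hW2 hb hH).trans
    (mul_le_mul_of_nonneg_right (exp_le_exp.2 ?_) (integral_nonneg fun _ => (exp_pos _).le))
  set R : ℝ := ‖gradient V x₀‖ / lam + Real.sqrt (n / lam) with hR
  set R₀ : ℝ := G₀ / lam + Real.sqrt (n / lam) with hR₀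
  have hR0 : 0 ≤ R := add_nonneg (div_nonneg (norm_nonneg _) hlam.le) (Real.sqrt_nonneg _)
  have hRR : R ≤ R₀ := add_le_add (div_le_div_of_nonneg_right hG hlam.le) le_rfl
  have hA1 : 0 ≤ A₁ := (norm_nonneg _).trans hA₁
  have h1 : ‖gradient W x₀‖ * R ≤ A₁ * R₀ :=
    (mul_le_mul_of_nonneg_right hA₁ hR0).trans (mul_le_mul_of_nonneg_left hRR hA1)
  have h2 : b * R ^ 2 ≤ b * R₀ ^ 2 := mul_le_mul_of_nonneg_left (pow_le_pow_left₀ hR0 hRR 2) hb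
  linarith

/-! ## §4 The junction: `LocCondStability` BY NAME from five numbers at the expansion point -/

section Junction

variable {Pt : Type} [DecidableEq Pt] {C : ℕ → Type} {𝒢 : (j : ℕ) → GoodClass (C j)}

/-- **LCS FOR THE TAYLOR-GROWTH CARRIER, ON THE SUPPORT — the family-(2) socket from VALUE, GRADIENT and HESSIAN BOUND of the one-step
exponent difference at the expansion point.**  At every pattern prefix `g` of a level `j < K` and background `y` let
`M j g y = ∫_{Kw} e^{−V} ∕ ∫_{Kw} e^{−(V+W)}` for the data at `(j, g, y)` — window `Kw j g y`, exponents `V j g y`, `W j g y`, nominal centre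
`x0 j g y` —; suppose `M j g` is a.e.-strongly measurable and ON THE SUPPORT OF THE TERM: `Kw` convex, bounded, measurable with `x0 ∈ Kw`;
`V ∈ C¹`, `lam j g`-uniformly convex ON `Kw`, `‖∇V x0‖ ≤ G₀ j g`; `W ∈ C²` with `D²W ≤ 2(b j g)` ON `Kw`, `W x0 ≤ A₀ j g`, `‖∇W x0‖ ≤ A₁ j g`;
`lam > 0`, `b ≥ 0` — the numbers `lam, A₀, A₁, b, G₀` y-UNIFORM, the fibre dimension `n j g`.  Then, with
`R₀ j g = G₀ j g∕lam j g + √(n j g∕lam j g)`, `LocCondStability T S K μ ρ₀ M (fun j g => A₀ + A₁·R₀ + b·R₀²)`, integrability conjunct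
included. [folklore] -/
theorem locCondStability_of_taylorGrowthCarrier_on_support (T : Tower Pt C 𝒢)
    (Spat : (j : ℕ) → (Fin j → Pt) → Finset Pt) (K : ℕ) [∀ j, MeasurableSpace (C j)] (μ : (j : ℕ) → Measure (C j))
    (ρ₀ : C 0 → ℝ) (M : (j : ℕ) → (Fin j → Pt) → C j → ℝ) (n : (j : ℕ) → (Fin j → Pt) → ℕ)
    (Kw : (j : ℕ) → (g : Fin j → Pt) → C j → Set (EuclideanSpace ℝ (Fin (n j g))))
    (V W : (j : ℕ) → (g : Fin j → Pt) → C j → EuclideanSpace ℝ (Fin (n j g)) → ℝ)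
    (x0 : (j : ℕ) → (g : Fin j → Pt) → C j → EuclideanSpace ℝ (Fin (n j g)))
    (lam A₀ A₁ b G₀ : (j : ℕ) → (Fin j → Pt) → ℝ) (hρ : (𝒢 0).Gd ρ₀) (h0 : ∀ x, 0 ≤ ρ₀ x)
    (hM : ∀ j g, j < K → g ∈ admS T Spat j → ∀ y, M j g y =
      (∫ x in Kw j g y, exp (-V j g y x)) / ∫ x in Kw j g y, exp (-(V j g y x + W j g y x)))
    (hMm : ∀ j g, j < K → g ∈ admS T Spat j → AEStronglyMeasurable (M j g) (μ j))
    (hlam : ∀ j g, j < K → g ∈ admS T Spat j → 0 < lam j g)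
    (hKc : ∀ j g, j < K → g ∈ admS T Spat j → ∀ y, T.eterm ρ₀ j g y ≠ 0 → Convex ℝ (Kw j g y))
    (hKm : ∀ j g, j < K → g ∈ admS T Spat j → ∀ y, T.eterm ρ₀ j g y ≠ 0 → MeasurableSet (Kw j g y))
    (hKb : ∀ j g, j < K → g ∈ admS T Spat j → ∀ y, T.eterm ρ₀ j g y ≠ 0 → Bornology.IsBounded (Kw j g y))
    (hx0 : ∀ j g, j < K → g ∈ admS T Spat j → ∀ y, T.eterm ρ₀ j g y ≠ 0 → x0 j g y ∈ Kw j g y)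
    (hV1 : ∀ j g, j < K → g ∈ admS T Spat j → ∀ y, T.eterm ρ₀ j g y ≠ 0 → ContDiff ℝ 1 (V j g y))
    (hV : ∀ j g, j < K → g ∈ admS T Spat j → ∀ y, T.eterm ρ₀ j g y ≠ 0 → ∀ x ∈ Kw j g y, ∀ z ∈ Kw j g y,
      V j g y x + ⟪gradient (V j g y) x, z - x⟫ + lam j g / 2 * ‖z - x‖ ^ 2 ≤ V j g y z)
    (hG : ∀ j g, j < K → g ∈ admS T Spat j → ∀ y, T.eterm ρ₀ j g y ≠ 0 → ‖gradient (V j g y) (x0 j g y)‖ ≤ G₀ j g)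
    (hW2 : ∀ j g, j < K → g ∈ admS T Spat j → ∀ y, T.eterm ρ₀ j g y ≠ 0 → ContDiff ℝ 2 (W j g y))
    (hb : ∀ j g, j < K → g ∈ admS T Spat j → 0 ≤ b j g)
    (hH : ∀ j g, j < K → g ∈ admS T Spat j → ∀ y, T.eterm ρ₀ j g y ≠ 0 →
      ∀ x ∈ Kw j g y, ∀ v : EuclideanSpace ℝ (Fin (n j g)), iteratedFDeriv ℝ 2 (W j g y) x ![v, v] ≤ 2 * b j g * ‖v‖ ^ 2)
    (hA₀ : ∀ j g, j < K → g ∈ admS T Spat j → ∀ y, T.eterm ρ₀ j g y ≠ 0 → W j g y (x0 j g y) ≤ A₀ j g)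
    (hA₁ : ∀ j g, j < K → g ∈ admS T Spat j → ∀ y, T.eterm ρ₀ j g y ≠ 0 → ‖gradient (W j g y) (x0 j g y)‖ ≤ A₁ j g)
    (hint : ∀ j g, j < K → g ∈ admS T Spat j → Integrable (T.eterm ρ₀ j g) (μ j)) :
    LocCondStability T Spat K μ ρ₀ M (fun j g => A₀ j g + A₁ j g * (G₀ j g / lam j g + Real.sqrt (n j g / lam j g)) +
      b j g * (G₀ j g / lam j g + Real.sqrt (n j g / lam j g)) ^ 2) := by
  refine locCondStability_of_carrier_le_on_support T Spat K μ ρ₀ M _ hρ h0 hMm (fun j g hj hg y => ?_)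
    (fun j g hj hg y hy => ?_) hint
  · rw [hM j g hj hg y]
    exact div_nonneg (integral_nonneg fun _ => (exp_pos _).le) (integral_nonneg fun _ => (exp_pos _).le)
  · rw [hM j g hj hg y]
    exact taylorGrowthCarrier_le (hlam j g hj hg) (hKc j g hj hg y hy) (hKm j g hj hg y hy) (hKb j g hj hg y hy) (hx0 j g hj hg y hy)
      (hV1 j g hj hg y hy) (hV j g hj hg y hy) (hG j g hj hg y hy) (hW2 j g hj hg y hy) (hb j g hj hg) (hH j g hj hg y hy)
      (hA₀ j g hj hg y hy) (hA₁ j g hj hg y hy)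

end Junction

end Summit.QuantumFields.BalabanUV.T4Continuum.NE7b.ConvexWindowTaylorGrowth

end
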